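import Summits.CriticalPhenomena.PercolationContinuityZ3.Theorems.RunbookPrimarySanity
import HarnessLib

/-!
# REVIEW-RUNBOOK sanity lemmas — JOINT SATISFIABILITY of hypothesis telescopes
# (clients `prim-primary`, `pub-peel`, `pub-sahi` of the ops review-runbook generator)

Card (2)(b) of the review runbooks («non-vacuity»): for a statement
`∀ objects, h₁ → … → hₙ → C` the kernel certifies the implication; whether SOME choice of the objects
meets ALL of `h₁ … hₙ` at once is what this file records, as CLOSED theorems
`∃ objects, h₁ ∧ … ∧ hₙ` (the shape the generator's probe — runbook-probe/12, block «Joint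
satisfiability of the hypotheses» — matches hypothesis by hypothesis).  Each witness is an
explicit, non-degenerate instance named in its docstring.

* `oneCut_card_le_four` (`Theorems/PercNearOneGluingNoHeavyLowerTailLonelyRelay.lean`): the
  TIGHT instance of `RunbookPrimarySanity` §2 — `Fin 5`, observer glued to relay `1`, relays
  `2,3,4` a blob, link `1–2` of weight `3/5`, `A = {1,2,3,4}`, `t = 2/5` (`pair_le_blobLink`);
  there the conclusion `≤ t` is an equality (`oneCut_card_le_four_tight`), so the witness sits
  exactly where the theorem has content (a witness with `t ≥ 1` would be idle: probabilities
  are `≤ 1`).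
* `CSH.cshAll` (`Theorems/PercNearOneGluingNoHeavyLowerTailCSHTheoremOne.lean`): `Fin 5`, all
  weights `1/2` (strictly inside `(0,1)`), `o = 0`, `v = 1`, `x = 2`, `Y = {3}`, detour list
  `D = [4]` — the nine side conditions (distinctness / disjointness / `Nodup`) hold together with
  `Y` and `D` NON-EMPTY.
* `SahiC3Cube.latticeE3_nonneg_cube_three` / `latticeE3fun_nonneg_cube_three`
  (`Theorems/PercNearOneGluingNoHeavyLowerTailSahiC3Cube*.lean`): on the cube `{0,1}³` the uniform
  weight `μ ≡ 1/8` (product Bernoulli(1/2), FKG lattice condition with equality) with the three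
  COORDINATE up-sets `{x | x i}` / their indicator functions (increasing, non-negative, not
  constant).

Nothing here is used by any theorem of the tree and nothing is a new mathematical claim; these are
reader-facing checks (`--supports`, the file closes no item).  No `sorry`, standard axioms, no
definitions.
-/

namespace Summit.CriticalPhenomena.PercolationContinuityZ3.Runbook.JointSatisfiability

open MeasureTheory
open Literature.Probability.LatticeModels Literature.Probability.Percolation
open Summit.CriticalPhenomena.PercolationContinuityZ3.Theorems.AdditiveGluing.Negative.Cert (wOfList)
open Summit.CriticalPhenomena.PercolationContinuityZ3.Runbook.Primary (pair_le_blobLink)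

/-! ### `oneCut_card_le_four` -/

/-- (b) **The three hypotheses of `oneCut_card_le_four` hold together**, at the tight instance of
`RunbookPrimarySanity` §2: `n = 5`, `w` = the weighted edge list `[(0,1,1), (1,2,3/5), (2,3,1), (3,4,1)]`
(weight `0` on every other pair), `A = {1,2,3,4}` (`|A| = 4 ≤ 4`), `t = 2/5 ≥ 0`, and every pairwise
disconnection probability inside `A` is `≤ 2/5` (`Runbook.Primary.pair_le_blobLink`).  At this
instance the theorem's bound is attained (`Runbook.Primary.oneCut_card_le_four_tight`). [folklore] -/
theorem oneCut_card_le_four_hypotheses :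
    ∃ (n : ℕ) (w : Sym2 (Fin n) → unitInterval) (A : Finset (Fin n)) (t : ℝ),
      A.card ≤ 4 ∧ 0 ≤ t ∧
        ∀ a ∈ A, ∀ a' ∈ A, a ≠ a' → (prodBernoulli w).real (openConn a a')ᶜ ≤ t :=
  ⟨5, wOfList [(0, 1, 1), (1, 2, 3/5), (2, 3, 1), (3, 4, 1)], {1, 2, 3, 4}, 2 / 5,
    by decide, by norm_num, pair_le_blobLink _ rfl⟩

/-! ### `CSH.cshAll` -/

/-- (b) **The nine side conditions of `CSH.cshAll` hold together, with `Y` and `D` non-empty**: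
`n = 5`, every weight `1/2` (so `0 < w e < 1`), `o = 0`, `v = 1`, `x = 2`, `Y = {3}`, `D = [4]`:
`o ≠ v`, `x ∉ Y`, `o ≠ x`, `v ≠ x`, `o ∉ Y`, `v ∉ Y`, `D.Nodup`, and every detour vertex avoids
`x`, `Y`, `o`, `v`. [folklore] -/
theorem cshAll_hypotheses :
    ∃ (n : ℕ) (w : Sym2 (Fin n) → unitInterval) (o v x : Fin n) (Y : Finset (Fin n))
      (D : List (Fin n)),
      (∀ e : Sym2 (Fin n), 0 < w e ∧ w e < 1) ∧ o ≠ v ∧ x ∉ Y ∧ o ≠ x ∧ v ≠ x ∧ o ∉ Y ∧ v ∉ Y ∧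
        D.Nodup ∧ ∀ d ∈ D, d ≠ x ∧ d ∉ Y ∧ d ≠ o ∧ d ≠ v := by
  refine ⟨5, fun _ => ⟨1 / 2, by norm_num, by norm_num⟩, 0, 1, 2, {3}, [4], fun _ => ⟨?_, ?_⟩,
    by decide, by decide, by decide, by decide, by decide, by decide, by decide, by decide⟩
  · exact Subtype.mk_lt_mk.2 (by norm_num)
  · exact Subtype.mk_lt_mk.2 (by norm_num)

/-! ### `SahiC3Cube.latticeE3_nonneg_cube_three` / `latticeE3fun_nonneg_cube_three` -/

/-- The coordinate up-set `{x | x i}` of the cube `{0,1}³` is an up-set. [folklore] -/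
theorem isUpperSet_coordinate (i : Fin 3) :
    IsUpperSet (↑(Finset.univ.filter fun x : Fin 3 → Bool => x i = true) : Set (Fin 3 → Bool)) := by
  intro a b hab ha
  simp only [Finset.coe_filter, Finset.mem_univ, true_and, Set.mem_setOf_eq] at ha ⊢
  exact Bool.le_iff_imp.1 (hab i) ha

/-- The indicator of the coordinate up-set `{x | x i}` is increasing on `{0,1}³`. [folklore] -/
theorem monotone_coordinateIndicator (i : Fin 3) :
    Monotone fun x : Fin 3 → Bool => if x i = true then (1 : ℝ) else 0 := by
  intro a b hab
  have h : a i = true → b i = true := Bool.le_iff_imp.1 (hab i)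
  dsimp only
  cases ha : a i <;> cases hb : b i
  · simp
  · simp
  · exact absurd (h ha) (by rw [hb]; exact Bool.false_ne_true)
  · simp

/-- (b) **The five hypotheses of `latticeE3_nonneg_cube_three` hold together, non-degenerately**:
`μ ≡ 1/8` on `{0,1}³` (product Bernoulli(1/2): `0 ≤ μ`, the FKG lattice condition
`μ a μ b ≤ μ (a ⊓ b) μ (a ⊔ b)` with equality) and `A, B, C` the three coordinate up-sets
`{x | x 0}`, `{x | x 1}`, `{x | x 2}`. [folklore] -/
theorem latticeE3_nonneg_cube_three_hypotheses :
    ∃ (μ : (Fin 3 → Bool) → ℝ) (A B C : Finset (Fin 3 → Bool)),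
      0 ≤ μ ∧ (∀ a b : Fin 3 → Bool, μ a * μ b ≤ μ (a ⊓ b) * μ (a ⊔ b)) ∧
        IsUpperSet (↑A : Set (Fin 3 → Bool)) ∧ IsUpperSet (↑B : Set (Fin 3 → Bool)) ∧
          IsUpperSet (↑C : Set (Fin 3 → Bool)) :=
  ⟨fun _ => 1 / 8, Finset.univ.filter fun x => x 0 = true, Finset.univ.filter fun x => x 1 = true,
    Finset.univ.filter fun x => x 2 = true, fun _ => by norm_num, fun _ _ => le_rfl,
    isUpperSet_coordinate 0, isUpperSet_coordinate 1, isUpperSet_coordinate 2⟩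

/-- (b) **The eight hypotheses of `latticeE3fun_nonneg_cube_three` hold together,
non-degenerately**: `μ ≡ 1/8` as above and `f, g, h` the indicators of the three coordinate
up-sets (increasing, non-negative, non-constant). [folklore] -/
theorem latticeE3fun_nonneg_cube_three_hypotheses :
    ∃ (μ : (Fin 3 → Bool) → ℝ) (f g h : (Fin 3 → Bool) → ℝ),
      0 ≤ μ ∧ (∀ a b : Fin 3 → Bool, μ a * μ b ≤ μ (a ⊓ b) * μ (a ⊔ b)) ∧
        Monotone f ∧ Monotone g ∧ Monotone h ∧
          (∀ x, 0 ≤ f x) ∧ (∀ x, 0 ≤ g x) ∧ (∀ x, 0 ≤ h x) :=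
  ⟨fun _ => 1 / 8, fun x => if x 0 = true then 1 else 0, fun x => if x 1 = true then 1 else 0,
    fun x => if x 2 = true then 1 else 0, fun _ => by norm_num, fun _ _ => le_rfl,
    monotone_coordinateIndicator 0, monotone_coordinateIndicator 1, monotone_coordinateIndicator 2,
    fun x => by dsimp only; split_ifs <;> norm_num, fun x => by dsimp only; split_ifs <;> norm_num,
    fun x => by dsimp only; split_ifs <;> norm_num⟩


/-! ### `sahiE3_cylinder_nonneg` -/

/-- (b) **The seven hypotheses of `sahiE3_cylinder_nonneg` hold together, non-degenerately** (appended
2026-09-04): on the two-point index set `Fin 2`, the cylinder base `a = {0}` and the free set `D = {1}`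
are disjoint, the edge densities `p ≡ 1/2` lie in `[0, 1]`, and `f = g = |S|` (the cardinality of a
subset, as a real number) are increasing and non-negative set functions. [folklore] -/
theorem sahiE3_cylinder_nonneg_hypotheses :
    ∃ (a D : Finset (Fin 2)) (p : Fin 2 → ℝ) (f g : Finset (Fin 2) → ℝ),
      Disjoint a D ∧ (∀ i, 0 ≤ p i) ∧ (∀ i, p i ≤ 1) ∧
        (∀ ⦃S T : Finset (Fin 2)⦄, S ⊆ T → f S ≤ f T) ∧ (∀ ⦃S T : Finset (Fin 2)⦄, S ⊆ T → g S ≤ g T) ∧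
          (∀ S, 0 ≤ f S) ∧ (∀ S, 0 ≤ g S) :=
  ⟨{0}, {1}, fun _ => 1 / 2, fun S => S.card, fun S => S.card, by decide, fun _ => by norm_num,
    fun _ => by norm_num, fun _ _ h => by dsimp only; exact_mod_cast Finset.card_le_card h,
    fun _ _ h => by dsimp only; exact_mod_cast Finset.card_le_card h, fun S => by positivity,
    fun S => by positivity⟩

end Summit.CriticalPhenomena.PercolationContinuityZ3.Runbook.JointSatisfiability
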